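import Summits.QuantumFields.YangMills.Theorems.ColdStartUniversalityLatticeLangevinGaugeTransformPath
import Summits.QuantumFields.YangMills.Theorems.ColdStartUniversalityLatticeLangevinNoiseRotationFiltration
import HarnessLib

/-!
# Route `ColdStartUniversality` (brick «G4(iv-b)», part 1 of gauge covariance in law of the SZZ dynamics):
# the `Ad_h`-ROTATED flat noise and the recombination identity

Helper file (seat `ym-line-csu-p1`, g11; `--supports stmt-QuantumFields-24810`).  For a lattice gauge transformation
`h : Site → G` the `Ad` matrix of `h_x` in the orthonormal basis `Eₙ` of `(M_N(ℂ), Re tr(X Yᴴ))` is the orthogonal real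
matrix `R^{(x)}_{mn} = ⟨ρ(h_x) Eₙ ρ(h_x)ᴴ, E_m⟩` (brick G3, `GaugeCovariance.sum_adCoeff_mul_adCoeff`); the **rotated
noise** of a flat lattice noise `W` is `(W^R)^{e,m} = Σₙ R^{(x)}_{mn} W^{e,n}`, `e = (x, i)`.

* `sum_adCoeff_smul_conj`, `sum_adCoeff_mul_conj_apply` — the recombination identity
  `Σ_m R_{mn} (√2 𝐩(E_m) ρ(g)) X C = ρ(g) (√2 𝐩(Eₙ) X) C` (from `Ad`-equivariance of `𝐩`), which is why the
  gauge-transformed Itô integrals against `W^R` sum to the conjugate of the original ones;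
* `rho_gaugeTransform` — `ρ((h·U)_e) = ρ(h_x) ρ(U_e) ρ(h_{x+eᵢ})ᴴ`;
* `isFlatBrownian_gaugeRotation` — ★ `W^R` is a flat noise (brick G1 `NoiseRotation.isFlatBrownian_orthogonal` with the
  block-diagonal orthogonal matrix `⊕ₑ R^{(x_e)}`: `sum_blockDiag_mul`, `blockDiag_transpose_mul_self`);
* `natFiltration_gaugeRotation_eq` — ★ `W^R` generates the same raw natural filtration as `W` (brick G4(i));
* `adMatrix_gauge_orthogonal` — the `Ad` matrices of an SU(2) gauge transformation are edgewise orthogonal.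

Used by `…GaugeCovariance` (the pathwise transfer `isSolution_gaugeTransform`).  THEOREMS ONLY, [folklore];
RECORD-rung R3 plumbing; no crux or summit is proved; the Yang–Mills mass gap is NOT proved.
-/

set_option autoImplicit false

noncomputable section

namespace Summit.QuantumFields.YangMills.Theorems.ColdStartUniversality.GaugeCovariance

open MeasureTheory ProbabilityTheory Filter Matrix
open scoped NNReal ENNReal BigOperators
open Literature.Probability.Process Literature.MathematicalPhysics.QuantumFieldTheory
open Literature.MathematicalPhysics.QuantumLattice (fundamentalRep fundamentalLatticeRep)

/-! ## The recombination identity (general lattice representation datum) -/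

section Algebra

variable {G : Type*} [Group G] [TopologicalSpace G] (r : LatticeRep G)

/-- ★ **The recombination identity behind `Σ_m J'^{e,m} = h_x (Σₙ J^{e,n}) h_yᴴ`**: for the `Ad` coefficients
`R_{mn} = ⟨ρ(g)Eₙρ(g)ᴴ, E_m⟩`, `Σ_m R_{mn} • ((√2 𝐩(E_m) ρ(g)) X C) = ρ(g) ((√2 𝐩(Eₙ)) X 1) C` for all matrices `X, C`
(`Ad`-equivariance of `𝐩` and `ρ(g)ᴴρ(g) = 1`). [folklore] -/
theorem sum_adCoeff_smul_conj (g : G) (n : NoiseIdx r.N) (R : Matrix (NoiseIdx r.N) (NoiseIdx r.N) ℝ)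
    (hR : ∀ m n', R m n' = hsForm r.N (r.ρ g * noiseDir n' * (r.ρ g)ᴴ) (noiseDir m))
    (X C : Matrix (Fin r.N) (Fin r.N) ℂ) :
    ∑ m : NoiseIdx r.N, R m n • (((Real.sqrt 2 : ℂ) • (r.lieProj (noiseDir m) * r.ρ g)) * X * C) =
      r.ρ g * (((Real.sqrt 2 : ℂ) • r.lieProj (noiseDir n)) * X * (1 : Matrix (Fin r.N) (Fin r.N) ℂ)) * C := by
  -- `Σ_m R_{mn} • 𝐩(E_m) = ρ(g) 𝐩(Eₙ) ρ(g)ᴴ`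
  have hsum : ∑ m : NoiseIdx r.N, R m n • r.lieProj (noiseDir m) = r.ρ g * r.lieProj (noiseDir n) * (r.ρ g)ᴴ := by
    rw [conj_lieProj_noiseDir r g n]
    exact Finset.sum_congr rfl fun m _ => by rw [hR m n]
  calc ∑ m : NoiseIdx r.N, R m n • (((Real.sqrt 2 : ℂ) • (r.lieProj (noiseDir m) * r.ρ g)) * X * C)
      = (Real.sqrt 2 : ℂ) • (((∑ m : NoiseIdx r.N, R m n • r.lieProj (noiseDir m)) * r.ρ g) * X * C) := by
        rw [Finset.sum_mul, Finset.sum_mul, Finset.sum_mul, Finset.smul_sum]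
        refine Finset.sum_congr rfl fun m _ => ?_
        rw [Matrix.smul_mul, Matrix.smul_mul, Matrix.smul_mul, Matrix.smul_mul, Matrix.smul_mul, smul_comm]
    _ = (Real.sqrt 2 : ℂ) • (r.ρ g * r.lieProj (noiseDir n) * X * C) := by
        rw [hsum, Matrix.mul_assoc (r.ρ g * r.lieProj (noiseDir n)) ((r.ρ g)ᴴ) (r.ρ g), conjTranspose_mul_rho,
          Matrix.mul_one]
    _ = r.ρ g * (((Real.sqrt 2 : ℂ) • r.lieProj (noiseDir n)) * X * (1 : Matrix (Fin r.N) (Fin r.N) ℂ)) * C := by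
        rw [Matrix.mul_one, Matrix.smul_mul, Matrix.mul_smul, Matrix.smul_mul]
        simp only [Matrix.mul_assoc]

/-- Entrywise form of `sum_adCoeff_smul_conj` with complex scalars: `Σ_m R_{mn} · ((√2 𝐩(E_m) ρ(g)) X C)_{ij}
= (ρ(g) ((√2 𝐩(Eₙ)) X 1) C)_{ij}`. [folklore] -/
theorem sum_adCoeff_mul_conj_apply (g : G) (n : NoiseIdx r.N) (R : Matrix (NoiseIdx r.N) (NoiseIdx r.N) ℝ)
    (hR : ∀ m n', R m n' = hsForm r.N (r.ρ g * noiseDir n' * (r.ρ g)ᴴ) (noiseDir m))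
    (X C : Matrix (Fin r.N) (Fin r.N) ℂ) (i j : Fin r.N) :
    ∑ m : NoiseIdx r.N, (R m n : ℂ) * (((Real.sqrt 2 : ℂ) • (r.lieProj (noiseDir m) * r.ρ g)) * X * C) i j =
      (r.ρ g * (((Real.sqrt 2 : ℂ) • r.lieProj (noiseDir n)) * X * (1 : Matrix (Fin r.N) (Fin r.N) ℂ)) * C) i j := by
  rw [← sum_adCoeff_smul_conj r g n R hR X C, Matrix.sum_apply]
  refine Finset.sum_congr rfl fun m _ => ?_
  rw [Matrix.smul_apply, Complex.real_smul]

/-- `ρ((h·U)_e) = ρ(h_x) ρ(U_e) ρ(h_{x+eᵢ})ᴴ` (coordinate form of `matrixConfig_gaugeTransform`). [folklore] -/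
theorem rho_gaugeTransform {d L : ℕ} (h : Literature.MathematicalPhysics.QuantumFieldTheory.Site d L → G)
    (v : GaugeConfig d L G) (e : Edge d L) :
    r.ρ (gaugeTransform h v e) = r.ρ (h e.1) * r.ρ (v e) * (r.ρ (h (e.1.shift e.2)))ᴴ :=
  congrFun (matrixConfig_gaugeTransform r h v) e

end Algebra

/-! ## The rotated noise: flat, same filtration -/

section Rotation

variable {L : ℕ} [NeZero L] {Ω : Type*} {mΩ : MeasurableSpace Ω} {P : Measure Ω}
  {W : ℝ≥0 → Ω → (Edge 3 L × NoiseIdx 2 → ℝ)}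

/-- The block-diagonal lift of edgewise matrices acts edgewise. [folklore] -/
theorem sum_blockDiag_mul (R : Edge 3 L → Matrix (NoiseIdx 2) (NoiseIdx 2) ℝ) (w : Edge 3 L × NoiseIdx 2 → ℝ)
    (p : Edge 3 L × NoiseIdx 2) :
    ∑ q : Edge 3 L × NoiseIdx 2, (Matrix.of fun p q : Edge 3 L × NoiseIdx 2 =>
        if p.1 = q.1 then R p.1 p.2 q.2 else 0) p q * w q = ∑ n : NoiseIdx 2, R p.1 p.2 n * w (p.1, n) := by
  classical
  rw [Fintype.sum_prod_type, Finset.sum_comm]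
  refine Finset.sum_congr rfl fun n _ => ?_
  simp only [Matrix.of_apply, ite_mul, zero_mul, Finset.sum_ite_eq, Finset.mem_univ, if_true]

/-- The block-diagonal lift of edgewise orthogonal matrices is orthogonal. [folklore] -/
theorem blockDiag_transpose_mul_self (R : Edge 3 L → Matrix (NoiseIdx 2) (NoiseIdx 2) ℝ)
    (hRo : ∀ e, (R e).transpose * R e = 1) :
    (Matrix.of fun p q : Edge 3 L × NoiseIdx 2 => if p.1 = q.1 then R p.1 p.2 q.2 else 0).transpose *
      (Matrix.of fun p q : Edge 3 L × NoiseIdx 2 => if p.1 = q.1 then R p.1 p.2 q.2 else 0) = 1 := by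
  classical
  ext q q'
  rw [Matrix.mul_apply, Matrix.one_apply]
  simp only [Matrix.transpose_apply, Matrix.of_apply]
  rw [Fintype.sum_prod_type]
  -- `Σ_e Σ_m [e = q.1] R e m q.2 · [e = q'.1] R e m q'.2`
  have hinner : ∀ e : Edge 3 L, (∑ m : NoiseIdx 2, (if e = q.1 then R e m q.2 else 0) * (if e = q'.1 then R e m q'.2 else 0)) =
      if e = q.1 then (if e = q'.1 then ((R e).transpose * R e) q.2 q'.2 else 0) else 0 := by
    intro e
    by_cases h1 : e = q.1
    · by_cases h2 : e = q'.1
      · rw [if_pos h1, if_pos h2, Matrix.mul_apply]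
        refine Finset.sum_congr rfl fun m _ => ?_
        rw [if_pos h1, if_pos h2, Matrix.transpose_apply]
      · rw [if_pos h1, if_neg h2]
        refine Finset.sum_eq_zero fun m _ => ?_
        rw [if_neg h2, mul_zero]
    · rw [if_neg h1]
      refine Finset.sum_eq_zero fun m _ => ?_
      rw [if_neg h1, zero_mul]
  simp_rw [hinner]
  rw [Finset.sum_ite_eq' Finset.univ q.1]
  simp only [Finset.mem_univ, if_true]
  by_cases h : q.1 = q'.1
  · rw [if_pos h, hRo, Matrix.one_apply]
    by_cases h2 : q.2 = q'.2
    · rw [if_pos h2, if_pos (Prod.ext h h2)]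
    · rw [if_neg h2, if_neg (fun hq => h2 (congrArg Prod.snd hq))]
  · rw [if_neg h, if_neg (fun hq => h (congrArg Prod.fst hq))]

/-- ★ **The gauge-rotated noise is flat**: for edgewise orthogonal `R e` (`(R e)ᵀ R e = 1`), the noise
`(t, ω, (e, m)) ↦ Σₙ R e m n · W t ω (e, n)` is a flat Brownian noise. [folklore] -/
theorem isFlatBrownian_gaugeRotation (hW : IsFlatBrownian W P) (R : Edge 3 L → Matrix (NoiseIdx 2) (NoiseIdx 2) ℝ)
    (hRo : ∀ e, (R e).transpose * R e = 1) :
    IsFlatBrownian (fun t ω (p : Edge 3 L × NoiseIdx 2) => ∑ n : NoiseIdx 2, R p.1 p.2 n * W t ω (p.1, n)) P := by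
  classical
  have e : (fun t ω (p : Edge 3 L × NoiseIdx 2) => ∑ n : NoiseIdx 2, R p.1 p.2 n * W t ω (p.1, n)) =
      fun t ω p => ∑ q, (Matrix.of fun p q : Edge 3 L × NoiseIdx 2 => if p.1 = q.1 then R p.1 p.2 q.2 else 0) p q *
        W t ω q := by
    funext t ω p
    exact (sum_blockDiag_mul R (W t ω) p).symm
  rw [e]
  exact NoiseRotation.isFlatBrownian_orthogonal hW _ (blockDiag_transpose_mul_self R hRo)

/-- Transport of `natFiltration_orthogonal_eq` along an equality of noises. [folklore] -/
theorem natFiltration_eq_of_eq_orthogonal (hW : IsFlatBrownian W P)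
    (Rb : Matrix (Edge 3 L × NoiseIdx 2) (Edge 3 L × NoiseIdx 2) ℝ) (hRb : Rb.transpose * Rb = 1)
    {W' : ℝ≥0 → Ω → (Edge 3 L × NoiseIdx 2 → ℝ)} (hW' : IsFlatBrownian W' P)
    (e : W' = fun t ω i => ∑ j, Rb i j * W t ω j) : hW'.natFiltration = hW.natFiltration := by
  classical
  subst e
  exact NoiseRotation.natFiltration_orthogonal_eq hW Rb hRb

/-- ★ **The gauge-rotated noise generates the same raw natural filtration as `W`.** [folklore] -/
theorem natFiltration_gaugeRotation_eq (hW : IsFlatBrownian W P) (R : Edge 3 L → Matrix (NoiseIdx 2) (NoiseIdx 2) ℝ)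
    (hRo : ∀ e, (R e).transpose * R e = 1)
    (hWR : IsFlatBrownian (fun t ω (p : Edge 3 L × NoiseIdx 2) => ∑ n : NoiseIdx 2, R p.1 p.2 n * W t ω (p.1, n)) P) :
    hWR.natFiltration = hW.natFiltration := by
  classical
  refine natFiltration_eq_of_eq_orthogonal hW _ (blockDiag_transpose_mul_self R hRo) hWR ?_
  funext t ω p
  exact (sum_blockDiag_mul R (W t ω) p).symm

omit [NeZero L] in
/-- The `Ad` matrices of an SU(2) gauge transformation are edgewise orthogonal. [folklore] -/
theorem adMatrix_gauge_orthogonal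
    (h : Literature.MathematicalPhysics.QuantumFieldTheory.Site 3 L → Matrix.specialUnitaryGroup (Fin 2) ℂ)
    (R : Edge 3 L → Matrix (NoiseIdx 2) (NoiseIdx 2) ℝ)
    (hR : ∀ (e : Edge 3 L) (m n : NoiseIdx (fundamentalLatticeRep 2).N), R e m n =
      hsForm (fundamentalLatticeRep 2).N ((fundamentalLatticeRep 2).ρ (h e.1) * noiseDir n *
        ((fundamentalLatticeRep 2).ρ (h e.1))ᴴ) (noiseDir m)) (e : Edge 3 L) :
    (R e).transpose * R e = 1 := by
  have hRe : R e = Matrix.of fun m n : NoiseIdx (fundamentalLatticeRep 2).N =>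
      hsForm (fundamentalLatticeRep 2).N ((fundamentalLatticeRep 2).ρ (h e.1) * noiseDir n *
        ((fundamentalLatticeRep 2).ρ (h e.1))ᴴ) (noiseDir m) := by
    ext m n
    rw [Matrix.of_apply]
    exact hR e m n
  rw [hRe]
  exact adMatrix_transpose_mul_self (fundamentalLatticeRep 2) (h e.1)

end Rotation

end Summit.QuantumFields.YangMills.Theorems.ColdStartUniversality.GaugeCovariance

end
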